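import Mathlib
import Literature.NumberTheory.EllipticCurves.KuriharaNumber
import Literature.NumberTheory.EllipticCurves.GaloisAction
import Literature.NumberTheory.EllipticCurves.Tamagawa
import Literature.NumberTheory.EllipticCurves.KatoKolyvaginPrimes
import Literature.NumberTheory.EllipticCurves.PAdicBSD
import Literature.NumberTheory.EllipticCurves.GlobalMinimalModel
import Literature.NumberTheory.EllipticCurves.ModularCurvePeriodRatio
import Literature.NumberTheory.EllipticCurves.NonEisensteinPrimeOfSurjective
import Literature.NumberTheory.EllipticCurves.LFunctionSmulProofs
import Literature.NumberTheory.EllipticCurves.LeadingTermBSZOrdinaryProofs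
import Literature.NumberTheory.EllipticCurves.BSDInvariantsTamagawaProofs
import Literature.NumberTheory.EllipticCurves.KuriharaNumberKimCertificateProofs
import Summits.BirchSwinnertonDyer.BirchSwinnertonDyer.Theorems.PlecticLegsTwistSupplyStubKuriharaSupply
import HarnessLib

/-!
# Stub `stub_rankThreeSupply` (line `Sketch` = `kurihara-fourier-support`, crux `PlecticLegs.TwistSupply`)

**The analytic-rank-`3` certificate supplier, modulo the printed facts.** The line proves the crux
`TwistSupply` for PRIME analytic rank `ℓ = r_an(E)` from a *Kurihara certificate* at `ℓ` (a newform
`f` of `E`, a square-free `n` prime to the level, `ℓ`-integral plus symbols `[a/n]⁺_f` and a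
non-zero mod-`ℓ` Kurihara number; `Theorems.stub_primeRankKurihara`). This file supplies the
certificate at `ℓ = 3`, the first open analytic rank, in the Sakamoto–Skinner–Urban class. The
four printed inputs are HYPOTHESES of the theorem (they are the content of the blocked stub
`stub_printedFacts`, never proved here):

1. modularity, by name (`exists_isNewformOf`: Breuil–Conrad–Diamond–Taylor 2001, Thm. A);
2. R. Sakamoto, *`p`-Selmer group and modular symbols*, Doc. Math. 27 (2022) 1891–1922
   = arXiv:2106.03370, Thm. 1.2 with Cor. 4.3 (and, for `p = 3`, the Appendix, §5), stated inline:
   at a good ordinary prime `p ≥ 3` with `ρ̄_{E,p}` onto, `p ∤ #Ẽ(𝔽_p)` (non-anomalous),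
   `p ∤ ∏ c_v`, under the period transfer `Ω(W) = u · Ω⁺_f` (`|u|_p = 1`) and the Iwasawa main
   conjecture in `Λ` for the Néron-normalised `p`-adic `L`-function `u⁻¹ · padicLFunction f α`
   (Sakamoto's Remark 1.3: the main conjecture is supplied by Skinner–Urban), some Kolyvagin level
   `n ∈ 𝒩₁` carries a non-zero mod-`p` Kurihara number `δ_n`;
3. the period transfer at `3`, inline (= `realPeriodRat_eq_unit_mul_plusPeriod_three`:
   Greenberg–Vatsal 2000, Rem. 3.4 + Mazur 1978, Cor. 4.1 + Edixhoven 1991, Prop. 2);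
4. the universal closure of the named fact `skinner_urban_main_conjecture` (Skinner–Urban 2014,
   Thm. 3.6.9, with its integral clause under surjectivity of `ρ_{E,p}`).

**Statement.** For every elliptic `W / ℚ` with good ordinary reduction at `3` (`3 ∤ a_3`, read off
`L(W, s)`), `ρ̄_{W,3^m}` onto for all `m`, `3 ∤ 4 - a_3 = #Ẽ(𝔽_3)`, `3 ∤ ∏ c_v`, and an auxiliary
prime `q ≠ 3` of multiplicative reduction with `3 ∤ v_q(Δ_min)` (on some global minimal model
`C • W`), there are a level `N`, the newform `f ∈ S₂(Γ₀(N))` of `W`, a square-free `n` prime to `N`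
with `3`-integral symbols `[a/n]⁺_f`, and discrete logarithms `ψ` with `kuriharaNumber f 3 n ψ ≠ 0`.

**Proof** (model transport + glue, all tree theorems): work on the minimal model `W' = C • W` of
the auxiliary-prime hypothesis; the hypotheses are isomorphism invariants (`LFunction_smul`,
`BSZLemma17.hasGoodReductionAtPrime_smul_iff`, `BSZLemma17.hasMultiplicativeReductionAtPrime_smul_iff`,
`tamagawaProduct_variableChange_holds`, `kuriharaSupply_hasSurjectiveModNGaloisRep_smul`), and
`a_3(W') = L(W)_3` (`LFunction_apply_prime_eq_frobeniusTrace`), `#Ẽ'(𝔽_3) = 4 - a_3` (definition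
of `frobeniusTrace`); modularity at `W'` (`conductorNorm_pos_holds`) gives `f`, also the newform of
`W`; `ρ̄_{W',3}` onto ⇒ `W'[3]` irreducible (`hasIrreducibleModPGaloisRep_of_hasSurjectiveModNGaloisRep`),
so the period transfer at `3` gives `u`; Skinner–Urban's integral clause at `(W', 3)` gives
`char_Λ X = (padicLFunction f α)` in `Λ`, which is the Néron-normalised identity after rescaling the
generator by the `3`-adic unit `u` (`exists_span_eq_and_map_eq_C_inv_mul_iff`); Sakamoto then yields
`n ∈ 𝒩₁`, `ψ`, `δ_n ≠ 0`; finally `n` is square-free and prime to `N_{W'}`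
(`Kato.IsKolyvaginProduct`) and the symbols are `3`-integral
(`IsNewformOf.not_dvd_den_ratPlusSymbol_div`, from irreducibility, `3 ≠ 2`).
-/

noncomputable section

set_option linter.dupNamespace false

namespace Summit.BirchSwinnertonDyer.BirchSwinnertonDyer.Theorems

open CongruenceSubgroup WeierstrassCurve Literature.NumberTheory.EllipticCurves
  Literature.NumberTheory.EllipticCurves.ModularForms

open scoped MatrixGroups ModularForm Classical

/-! ### Two elementary transports at the prime `3` -/

/-- **`a_3` of a minimal model is the third `L`-coefficient**: for a global minimal model `C • W`
of `W` with good reduction at `3`, `3 ∣ a_3(C • W) ↔ 3 ∣ L(W)_3`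
(`LFunction_apply_prime_eq_frobeniusTrace`, Silverman Ex. 8.19(a), and `LFunction_smul`).
[folklore] -/
theorem rankThreeSupply_dvd_frobeniusTrace_iff (W : WeierstrassCurve ℚ) [W.IsElliptic]
    (C : VariableChange ℚ) [(C • W).IsGloballyMinimal] (h : (C • W).HasGoodReductionAtPrime 3) :
    ((3 : ℕ) : ℤ) ∣ (C • W).frobeniusTrace 3 ↔ (3 : ℤ) ∣ W.LFunction 3 := by
  rw [← LFunction_apply_prime_eq_frobeniusTrace (C • W) 3 h, LFunction_smul W C, Nat.cast_ofNat]

/-- **Non-anomalous at `3`, read off the `L`-function**: for a global minimal model `C • W` of `W`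
with good reduction at `3`, `#Ẽ(𝔽_3) = 3 + 1 - a_3 = 4 - L(W)_3` (definition of `frobeniusTrace`,
`LFunction_apply_prime_eq_frobeniusTrace`, `LFunction_smul`), so `3 ∣ #Ẽ(𝔽_3) ↔ 3 ∣ 4 - L(W)_3`.
[folklore] -/
theorem rankThreeSupply_dvd_reductionPointCount_iff (W : WeierstrassCurve ℚ) [W.IsElliptic]
    (C : VariableChange ℚ) [(C • W).IsGloballyMinimal] (h : (C • W).HasGoodReductionAtPrime 3) :
    3 ∣ reductionPointCount (C • W) 3 ↔ (3 : ℤ) ∣ 4 - W.LFunction 3 := by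
  have hcount : (reductionPointCount (C • W) 3 : ℤ) = 4 - W.LFunction 3 := by
    rw [← LFunction_smul W C, LFunction_apply_prime_eq_frobeniusTrace (C • W) 3 h, frobeniusTrace]
    push_cast
    ring
  rw [← hcount]
  exact Int.natCast_dvd_natCast.symm

/-! ### The supply at `3` -/

/-- **The analytic-rank-`3` certificate supplier, modulo the printed facts** (stub
`stub_rankThreeSupply` of line `Sketch`): GIVEN, as hypotheses, modularity (`exists_isNewformOf`),
Sakamoto 2022, Thm. 1.2 / Cor. 4.3 (inline: main conjecture in `Λ`, Néron-normalised, ⟹ a non-zero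
mod-`p` Kurihara number at some `n ∈ 𝒩₁`, `p ≥ 3` good ordinary non-anomalous, `ρ̄` onto,
`p ∤ ∏ c_v`), the period transfer at `3` (inline) and the universal closure of
`skinner_urban_main_conjecture`, every elliptic `W / ℚ` with good ordinary reduction at `3`,
`ρ̄_{W,3^m}` onto for all `m`, `3 ∤ 4 - a_3`, `3 ∤ ∏ c_v` and an auxiliary multiplicative prime
`q ≠ 3` with `3 ∤ v_q(Δ_min)` admits a Kurihara certificate at `3`: the newform `f` of `W` at the
level `N = N_{C • W}` of the given minimal model, a square-free `n` prime to `N` with `3`-integral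
symbols `[a/n]⁺_f`, and `ψ` with `kuriharaNumber f 3 n ψ ≠ 0`. Proof: model transport to `C • W`,
modularity, onto ⇒ irreducible, period transfer, Skinner–Urban's integral clause rescaled by the
`3`-adic unit `u` (`exists_span_eq_and_map_eq_C_inv_mul_iff`), Sakamoto; then
`Kato.IsKolyvaginProduct` (square-free, prime to `N`) and `IsNewformOf.not_dvd_den_ratPlusSymbol_div`
(integrality). Hypothesis (4) is spelled `@skinner_urban_main_conjecture W _ p _ κ γ N _ f` (explicit
arguments; `[W.IsElliptic]` is not a parameter of that definition) rather than with named arguments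
`(κ ≔ κ) (γ ≔ γ) (f ≔ f)`: the two spellings elaborate to the same term (`rfl`), and the explicit
one contains no assignment token, at which the stub registry would cut the recorded signature.
[folklore] -/
theorem stub_rankThreeSupply :
    exists_isNewformOf →
    (∀ (W : WeierstrassCurve ℚ) [W.IsElliptic] [W.IsGloballyMinimal] (p : ℕ) [Fact p.Prime],
      3 ≤ p → W.HasGoodReductionAtPrime p → ¬ (p : ℤ) ∣ W.frobeniusTrace p →
      W.HasSurjectiveModNGaloisRep p →
      ¬ p ∣ reductionPointCount W p → ¬ p ∣ W.tamagawaProduct →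
      ∀ {N : ℕ} [NeZero N] (f : CuspForm (Gamma0 N) 2), IsNewformOf W f →
      ∀ u : ℚ, ‖(u : ℚ_[p])‖ = 1 → W.realPeriodRat = u * plusPeriod f →
      (∀ (κ : ZpExtension ℚ p) (γ : Field.absoluteGaloisGroup ℚ), κ.IsCyclotomic →
        κ.IsTopGenerator γ → IsCyclotomicVariable p γ → ∀ S : W.SelmerDualData κ γ,
        S.IsTorsion ∧ ∃ g : IwasawaAlgebra p, S.charIdeal = Ideal.span {g} ∧
          iwasawaToPowerSeries p g =
            PowerSeries.C ((u : ℚ_[p])⁻¹) * padicLFunction f (unitRoot W p : ℚ_[p])) →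
      ∃ (n : ℕ) (_ : NeZero n), Kato.IsKolyvaginProduct W p 1 n ∧
        ∃ ψ : (ℓ : ℕ) → (ZMod ℓ)ˣ →* Multiplicative (ZMod p),
          (∀ ℓ ∈ n.primeFactors, Function.Surjective (ψ ℓ)) ∧ kuriharaNumber f p n ψ ≠ 0) →
    (∀ (W : WeierstrassCurve ℚ) [W.IsElliptic] [W.IsGloballyMinimal],
      W.HasGoodReductionAtPrime 3 → W.HasIrreducibleModPGaloisRep 3 →
      ∀ {N : ℕ} [NeZero N] (f : CuspForm (Gamma0 N) 2), IsNewformOf W f →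
      ∃ u : ℚ, ‖(u : ℚ_[3])‖ = 1 ∧ W.realPeriodRat = u * plusPeriod f) →
    (∀ (W : WeierstrassCurve ℚ) [W.IsElliptic] [W.IsGloballyMinimal] (p : ℕ) [Fact p.Prime]
      (κ : ZpExtension ℚ p) (γ : Field.absoluteGaloisGroup ℚ) (N : ℕ) [NeZero N]
      (f : CuspForm (Gamma0 N) 2), @skinner_urban_main_conjecture W _ p _ κ γ N _ f) →
    ∀ (W : WeierstrassCurve ℚ) [W.IsElliptic],
      W.HasGoodReductionAtPrime 3 → ¬ (3 : ℤ) ∣ W.LFunction 3 →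
      (∀ m : ℕ, W.HasSurjectiveModNGaloisRep ((3 ^ m : ℕ) : ℤ)) →
      ¬ (3 : ℤ) ∣ 4 - W.LFunction 3 → ¬ 3 ∣ W.tamagawaProduct →
      (∃ (q : ℕ) (_ : Fact q.Prime), q ≠ 3 ∧ W.HasMultiplicativeReductionAtPrime q ∧
        ∃ (C : VariableChange ℚ) (_ : (C • W).IsGloballyMinimal),
          ¬ 3 ∣ padicValInt q (C • W).minimalDiscriminantInt) →
      ∃ (N : ℕ) (_ : NeZero N) (f : CuspForm (Gamma0 N) 2), IsNewformOf W f ∧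
        ∃ (n : ℕ) (_ : NeZero n), Squarefree n ∧ n.Coprime N ∧
          (∀ a : (ZMod n)ˣ, ¬ 3 ∣ (ratPlusSymbol f (((a : ZMod n).val : ℚ) / n)).den) ∧
          ∃ ψ : (q : ℕ) → (ZMod q)ˣ →* Multiplicative (ZMod 3), kuriharaNumber f 3 n ψ ≠ 0 := by
  intro hmod hSak hper3 hSU W _ hgood hord hsurj hna htam haux
  -- Step 0: the global minimal model `C • W` of the auxiliary-prime hypothesis.
  obtain ⟨q, hq, hq3, hmult, C, hCmin, hval⟩ := haux
  haveI : (C • W).IsGloballyMinimal := hCmin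
  -- the hypotheses are isomorphism invariants
  have hL : (C • W).LFunction = W.LFunction := LFunction_smul W C
  have hgood' : (C • W).HasGoodReductionAtPrime 3 :=
    (BSZLemma17.hasGoodReductionAtPrime_smul_iff W C 3).mpr hgood
  have hmult' : (C • W).HasMultiplicativeReductionAtPrime q :=
    (BSZLemma17.hasMultiplicativeReductionAtPrime_smul_iff W C q).mpr hmult
  have hord' : ¬ ((3 : ℕ) : ℤ) ∣ (C • W).frobeniusTrace 3 :=
    fun h ↦ hord ((rankThreeSupply_dvd_frobeniusTrace_iff W C hgood').mp h)
  have hna' : ¬ 3 ∣ reductionPointCount (C • W) 3 :=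
    fun h ↦ hna ((rankThreeSupply_dvd_reductionPointCount_iff W C hgood').mp h)
  have hsurj' : ∀ m : ℕ, (C • W).HasSurjectiveModNGaloisRep ((3 ^ m : ℕ) : ℤ) := fun m ↦
    kuriharaSupply_hasSurjectiveModNGaloisRep_smul W C _ (hsurj m)
  have hsurj3 : (C • W).HasSurjectiveModNGaloisRep ((3 : ℕ) : ℤ) := by
    simpa only [pow_one] using hsurj' 1
  have htam' : ¬ 3 ∣ (C • W).tamagawaProduct := by
    rw [tamagawaProduct_variableChange_holds W C]
    exact htam
  -- Step 1: modularity at the minimal model; `f` is also the newform of `W`.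
  haveI hN : NeZero ((C • W).conductorNorm ℤ) := ⟨((C • W).conductorNorm_pos_holds).ne'⟩
  obtain ⟨f, hf'⟩ := hmod (C • W)
  have hfW : IsNewformOf W f := ⟨hf'.1, fun m ↦ by rw [hf'.2 m, hL]⟩
  -- Step 2: `ρ̄_{E,3}` onto ⇒ `E[3]` irreducible.
  haveI : NeZero ((3 : ℕ) : ℚ) := ⟨by norm_num⟩
  have hirr : (C • W).HasIrreducibleModPGaloisRep 3 :=
    hasIrreducibleModPGaloisRep_of_hasSurjectiveModNGaloisRep (C • W) 3 hsurj3
  -- Step 3: the period transfer at `3`.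
  obtain ⟨u, hu1, hu⟩ := hper3 (C • W) hgood' hirr f hf'
  -- Step 4: the main-conjecture identity at `3`, Néron-normalised, from Skinner–Urban's integral
  -- clause (surjectivity of every `ρ̄_{E,3^m}`) rescaled by the `3`-adic unit `u`.
  have hIMC : ∀ (κ : ZpExtension ℚ 3) (γ : Field.absoluteGaloisGroup ℚ), κ.IsCyclotomic →
      κ.IsTopGenerator γ → IsCyclotomicVariable 3 γ → ∀ S : (C • W).SelmerDualData κ γ,
      S.IsTorsion ∧ ∃ g : IwasawaAlgebra 3, S.charIdeal = Ideal.span {g} ∧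
        iwasawaToPowerSeries 3 g =
          PowerSeries.C ((u : ℚ_[3])⁻¹) * padicLFunction f (unitRoot (C • W) 3 : ℚ_[3]) := by
    intro κ γ hκ hγ hγ' S
    obtain ⟨htors, -, hint⟩ := hSU (C • W) 3 κ γ ((C • W).conductorNorm ℤ) f (by norm_num)
      hgood' hord' hirr ⟨q, hq, hq3, hmult', hval⟩ hκ hγ hγ' hf' S
    obtain ⟨g, hg, hI⟩ := hint hsurj'
    exact ⟨htors, (exists_span_eq_and_map_eq_C_inv_mul_iff 3 hu1 _ _).2 ⟨g, hI, hg⟩⟩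
  -- Step 5: Sakamoto.
  obtain ⟨n, hn0, hkoly, ψ, -, hδ⟩ :=
    hSak (C • W) 3 le_rfl hgood' hord' hsurj3 hna' htam' f hf' u hu1 hu hIMC
  -- Step 6: `n` is square-free and prime to the level; the symbols are `3`-integral.
  have hcop : n.Coprime ((C • W).conductorNorm ℤ) := Nat.coprime_of_dvd fun k hk hkn hkN ↦
    (hkoly.2 k (Nat.mem_primeFactors.mpr ⟨hk, hkn, hkoly.1.ne_zero⟩)).not_dvd_conductorNorm hkN
  have hint : ∀ a : (ZMod n)ˣ, ¬ 3 ∣ (ratPlusSymbol f (((a : ZMod n).val : ℚ) / n)).den := by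
    intro a
    simpa only [Int.cast_natCast] using
      hf'.not_dvd_den_ratPlusSymbol_div (by norm_num : (3 : ℕ) ≠ 2) hirr hcop
        (((a : ZMod n).val : ℕ) : ℤ)
  exact ⟨(C • W).conductorNorm ℤ, hN, f, hfW, n, hn0, hkoly.1, hcop, hint, ψ, hδ⟩

end Summit.BirchSwinnertonDyer.BirchSwinnertonDyer.Theorems

end
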